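import Mathlib

/-!
# Tier4/Common/CosetCoveringBound — the measure of a compact set inside a translate of a `Z`-SATURATED box is at most the
open-coset count of the compact set times the measure of the compact-open core `(Z ⊓ B₀) · B`

Blind re-derivation cell `pub-hodge-repro`, Tier 4 (README §9–§10), seat t4-typer-1 (gen 3).  Target tree path
`lean/Summits/Ventures/HodgeRepro/Tier4/Common/CosetCoveringBound.lean`.  Imports Mathlib only.

WHAT IS TYPED — the GENERIC core of **P4 of the folded ratio (F)** (t4-L2-p3 S15509 (2)(P4), plan-4's ruling S15514, the
lead's ask S15574): «the disintegration along the diagonal centre at `q`: for a compact `C ⊆ T_q × T′_q` and a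
`Δ(Z_q)`-invariant measurable `S`, `m(C ∩ S) ≤ κ(C) · m(Δ(Z_q)(L × L′))`-type bound».  Mathlib's quotient-measure /
fundamental-domain theory is for COUNTABLE (discrete) subgroups, and `Z_q` is not discrete (and at a split place not even
compact, so `m(Δ(Z_q)(L × L′)) = ∞` there); no quotient measure is used here.  Instead the bound is obtained by COSET COUNTING
against an open subgroup `B₀` (the level-`1` box `(T_q ∩ K(1)) × (T′_q ∩ K(1))`): with `Z⁰ := Z ⊓ B₀` (compact open in `Z`),
* `Z · B = ⋃_{γ ∈ Z} γ · (Z⁰ · B)` and two translates `γ · (Z⁰ · B)`, `γ′ · (Z⁰ · B)` with `γ⁻¹ γ′ ∉ B₀` lie in DIFFERENT left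
  cosets of `B₀` (`smul_inter_smul_mul_subset`: a single `B₀`-coset meets `a · (Z · B)` inside ONE translate of `Z⁰ · B`);
* a compact `C` meets only finitely many left cosets of the open subgroup `B₀` (`exists_finset_cover_smul_of_isCompact`);
hence `μ (C ∩ a · (Z · B)) ≤ (#cosets of B₀ meeting C) · μ (Z⁰ · B)` for every left-invariant `μ`, every subgroup `Z`, every
`B ⊆ B₀` and every translate `a` — `measure_inter_smul_mul_le_of_cover` (with the finite cover as a binder) and
`exists_nat_forall_measure_inter_smul_mul_le` (the constant `κ(C)` produced from compactness, UNIFORM in `Z`, `B`, `a`, hence in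
the level `n`).  `measure_inter_le_of_subset_smul_mul` is the form for a set `S ⊆ a · (Z · B)` (the support set of (F) after P2,
which sits inside one translate of `Δ(Z_q) · (L_{n−c₀} × L′_{n−c₀})`).  No measurability, no σ-finiteness, no compactness of `Z`
is assumed anywhere: the bounds are outer-measure bounds from `measure_mono`, `measure_biUnion_finset_le` and `measure_smul`.

The unit on the right is `μ ((Z ⊓ B₀) · B)`, the measure of a compact-open subgroup when `B` is one (the core of the saturated
box `Z · B`); relating it to the unfolded unit `suppMeasure N γ₀` (L2-p3's (v) `V(N)` and P1's product structure) is the glue's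
business, not this module's.

Nothing here says anything about the status of the Hodge conjecture for CM abelian varieties, which is NOT proved
(HC_CM is NOT proved by anyone in this repository).
-/

set_option autoImplicit false

noncomputable section

open MeasureTheory Measure Set Function
open scoped NNReal ENNReal Pointwise

namespace Summit.Ventures.HodgeRepro.Tier4.Common

section Covering

variable {A : Type*} [Group A] [TopologicalSpace A] [ContinuousMul A]

/-- **A compact set meets only finitely many left cosets of an open subgroup**: there is a finite set `F` of group elements
with `C ⊆ ⋃ g ∈ F, g • B₀`. -/
theorem exists_finset_cover_smul_of_isCompact (B₀ : Subgroup A) (hB₀ : IsOpen (B₀ : Set A)) {C : Set A}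
    (hC : IsCompact C) : ∃ F : Finset A, C ⊆ ⋃ g ∈ F, g • (B₀ : Set A) := by
  have hcov : C ⊆ ⋃ g ∈ C, g • (B₀ : Set A) := fun x hx =>
    mem_iUnion₂.2 ⟨x, hx, ⟨1, B₀.one_mem, by simp⟩⟩
  obtain ⟨b', -, hfin, hsub⟩ := hC.elim_finite_subcover_image (fun g _ => hB₀.leftCoset g) hcov
  refine ⟨hfin.toFinset, fun x hx => ?_⟩
  obtain ⟨g, hg, hxg⟩ := mem_iUnion₂.1 (hsub hx)
  exact mem_iUnion₂.2 ⟨g, hfin.mem_toFinset.2 hg, hxg⟩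

end Covering

section Cosets

variable {A : Type*} [Group A]

/-- **One coset of `B₀` meets `a • (Z * B)` inside one translate of the core `(Z ⊓ B₀) * B`**: if `a * z * b ∈ g • B₀` with
`z ∈ Z`, `b ∈ B ⊆ B₀`, then `g • B₀ ∩ a • (Z * B) ⊆ (a * z) • ((Z ⊓ B₀) * B)`.  (For `y = a * z' * b'` in the intersection,
`z⁻¹ * z' = b * (a z b)⁻¹ * y * b'⁻¹ ∈ B₀`.) -/
theorem smul_inter_smul_mul_subset (B₀ Z : Subgroup A) {B : Set A} (hB : B ⊆ B₀) (a g : A) {z : A} (hz : z ∈ Z)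
    {b : A} (hb : b ∈ B) (hmem : a * z * b ∈ g • (B₀ : Set A)) :
    g • (B₀ : Set A) ∩ a • ((Z : Set A) * B) ⊆ (a * z) • (((Z ⊓ B₀ : Subgroup A) : Set A) * B) := by
  rintro y ⟨hy, hy'⟩
  obtain ⟨w, hw, rfl⟩ := hy'
  obtain ⟨z', hz', b', hb', rfl⟩ := hw
  rw [mem_smul_set_iff_inv_smul_mem, smul_eq_mul] at hmem hy
  have hB₀ : (g⁻¹ * (a * z * b))⁻¹ * (g⁻¹ * (a * (z' * b'))) ∈ B₀ := B₀.mul_mem (B₀.inv_mem hmem) hy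
  have hzz : z⁻¹ * z' ∈ B₀ := by
    have : z⁻¹ * z' = b * ((g⁻¹ * (a * z * b))⁻¹ * (g⁻¹ * (a * (z' * b')))) * b'⁻¹ := by group
    rw [this]
    exact B₀.mul_mem (B₀.mul_mem (hB hb) hB₀) (B₀.inv_mem (hB hb'))
  refine ⟨z⁻¹ * z' * b', ⟨z⁻¹ * z', ⟨Z.mul_mem (Z.inv_mem hz) hz', hzz⟩, b', hb', rfl⟩, ?_⟩
  simp only [smul_eq_mul]
  group

end Cosets

section Measure

variable {A : Type*} [Group A] [MeasurableSpace A] (μ : Measure A) [μ.IsMulLeftInvariant]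

/-- **The coset-covering bound with an explicit finite cover**: if `C ⊆ ⋃ g ∈ F, g • B₀` (`F` finite) and `B ⊆ B₀`, then for
every subgroup `Z` and every translate `a`,
`μ (C ∩ a • (Z * B)) ≤ F.card * μ ((Z ⊓ B₀) * B)`.
No measurability of `C`, `B`, `Z` is assumed (outer-measure bound). -/
theorem measure_inter_smul_mul_le_of_cover (B₀ Z : Subgroup A) {B : Set A} (hB : B ⊆ B₀) {C : Set A} {F : Finset A}
    (hF : C ⊆ ⋃ g ∈ F, g • (B₀ : Set A)) (a : A) :
    μ (C ∩ a • ((Z : Set A) * B)) ≤ F.card * μ (((Z ⊓ B₀ : Subgroup A) : Set A) * B) := by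
  calc μ (C ∩ a • ((Z : Set A) * B))
      ≤ μ (⋃ g ∈ F, (g • (B₀ : Set A) ∩ a • ((Z : Set A) * B))) := by
        apply measure_mono
        rintro x ⟨hxC, hx⟩
        obtain ⟨g, hg, hxg⟩ := mem_iUnion₂.1 (hF hxC)
        exact mem_iUnion₂.2 ⟨g, hg, hxg, hx⟩
    _ ≤ ∑ g ∈ F, μ (g • (B₀ : Set A) ∩ a • ((Z : Set A) * B)) := measure_biUnion_finset_le F _
    _ ≤ ∑ _g ∈ F, μ (((Z ⊓ B₀ : Subgroup A) : Set A) * B) := by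
        refine Finset.sum_le_sum fun g _ => ?_
        by_cases h : (g • (B₀ : Set A) ∩ a • ((Z : Set A) * B)).Nonempty
        · obtain ⟨x, hxg, hx⟩ := h
          obtain ⟨w, hw, rfl⟩ := hx
          obtain ⟨z, hz, b, hb, rfl⟩ := hw
          calc μ (g • (B₀ : Set A) ∩ a • ((Z : Set A) * B))
              ≤ μ ((a * z) • (((Z ⊓ B₀ : Subgroup A) : Set A) * B)) :=
                measure_mono (smul_inter_smul_mul_subset B₀ Z hB a g hz hb (by simpa [mul_assoc] using hxg))
            _ = μ (((Z ⊓ B₀ : Subgroup A) : Set A) * B) := measure_smul μ (a * z) _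
        · rw [not_nonempty_iff_eq_empty.1 h, measure_empty]
          exact zero_le
    _ = F.card * μ (((Z ⊓ B₀ : Subgroup A) : Set A) * B) := by
        rw [Finset.sum_const, nsmul_eq_mul]

/-- The same bound for a set `S ⊆ a • (Z * B)` (the support set after P2: it sits inside ONE translate of the saturated box). -/
theorem measure_inter_le_of_subset_smul_mul (B₀ Z : Subgroup A) {B : Set A} (hB : B ⊆ B₀) {C : Set A} {F : Finset A}
    (hF : C ⊆ ⋃ g ∈ F, g • (B₀ : Set A)) {a : A} {S : Set A} (hS : S ⊆ a • ((Z : Set A) * B)) :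
    μ (C ∩ S) ≤ F.card * μ (((Z ⊓ B₀ : Subgroup A) : Set A) * B) :=
  (measure_mono (inter_subset_inter_right C hS)).trans (measure_inter_smul_mul_le_of_cover μ B₀ Z hB hF a)

variable [TopologicalSpace A] [ContinuousMul A]

/-- **P4, generic form — the constant `κ(C)`**: for an open subgroup `B₀` and a compact `C` there is `κ : ℕ` such that for EVERY
subgroup `Z`, every `B ⊆ B₀` and every translate `a`,
`μ (C ∩ a • (Z * B)) ≤ κ * μ ((Z ⊓ B₀) * B)`.
`κ` depends on `C` and `B₀` only — uniform in the level (`B = L_n × L′_n`), in `Z` and in the translate. -/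
theorem exists_nat_forall_measure_inter_smul_mul_le (B₀ : Subgroup A) (hB₀ : IsOpen (B₀ : Set A)) {C : Set A}
    (hC : IsCompact C) :
    ∃ κ : ℕ, ∀ (Z : Subgroup A) (B : Set A), B ⊆ B₀ → ∀ a : A,
      μ (C ∩ a • ((Z : Set A) * B)) ≤ κ * μ (((Z ⊓ B₀ : Subgroup A) : Set A) * B) := by
  obtain ⟨F, hF⟩ := exists_finset_cover_smul_of_isCompact B₀ hB₀ hC
  exact ⟨F.card, fun Z B hB a => measure_inter_smul_mul_le_of_cover μ B₀ Z hB hF a⟩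

/-- **P4 for an invariant set**: the same constant serves every `S ⊆ a • (Z * B)`. -/
theorem exists_nat_forall_measure_inter_le (B₀ : Subgroup A) (hB₀ : IsOpen (B₀ : Set A)) {C : Set A}
    (hC : IsCompact C) :
    ∃ κ : ℕ, ∀ (Z : Subgroup A) (B : Set A), B ⊆ B₀ → ∀ (a : A) (S : Set A), S ⊆ a • ((Z : Set A) * B) →
      μ (C ∩ S) ≤ κ * μ (((Z ⊓ B₀ : Subgroup A) : Set A) * B) := by
  obtain ⟨F, hF⟩ := exists_finset_cover_smul_of_isCompact B₀ hB₀ hC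
  exact ⟨F.card, fun Z B hB a S hS => measure_inter_le_of_subset_smul_mul μ B₀ Z hB hF hS⟩

end Measure

end Summit.Ventures.HodgeRepro.Tier4.Common

end
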